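import Literature.MathematicalPhysics.QuantumFieldTheory.Balaban1983to89.B9CubeSequence408

/-!
# `Balaban1983to89.B9CubeCoarsening` — THE CUBE SEQUENCE `{Ω_n(□)}` OF [B9] SECT. C REFINES THE MEMBER'S FAMILY: its blocks nest in the
# member's blocks, the (2.46) distance of the member is AT MOST that of the cube sequence (coarsening is a contraction of the bond graph),
# levels only drop, and near □ nothing changes — the dictionary that carries block majorants of the cube-local letters (cube geometry,
# `…L0` lineage) to the member's geometry (def-Y ∕ p21 ∕ p38 currency)  (sub-row G-B9-LETTERS, module M5.1a, file 1b)

FRAMING (verbatim cell line):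
statement-level skeleton of published theorems with citation tags; proofs where landed; nothing here is a claim about the Yang–Mills mass gap

Sources under audit (cell lit-balaban): T. Bałaban, *Propagators for lattice gauge theories in a background field*, Commun. Math. Phys. **99**
(1985) 389–434 [`Balaban1985BackgroundPropagators`, "B9"], Sect. C pp. 408–409; T. Bałaban, *Propagators and renormalization transformations
for lattice gauge theories. II*, Commun. Math. Phys. **96** (1984) 223–250 [`Balaban1984PropagatorsII`, "[4]"], (2.1)–(2.4) p. 224, (2.45)–(2.46)
p. 231, (2.51) p. 232.  Unit `lit-balaban-r05` (r05 gen 77); B9 fold owner r06, B6 fold owner r03.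

## WHAT IS PRINTED (verbatim up to notation)

[B9] p. 408: «Ω_{j+1}(□) = □̃³ ∩ B^{j+1}(Λ_{j+1}). We take Ω_j(□) = □̃⁴ … Ω_n(□) is a cube with a center at the center of □ … This sequence satisfies
the conditions (2.1), (2.2) with j instead of k»; p. 409: «|(K(h_□)G′_□h_□λ)(x)| ≦ O(M⁻¹)e^{−δ₀(Lʲη)⁻¹|y−y′|}|λ| (3.89) for x ∈ Δ(y), supp λ ⊂ Δ(y′),
y, y′ ∈ □ ∈ 𝒟_j. It is exactly the bound (2.44) of [4]» — the cube letters' bounds are USED in the member's blocks `Δ(y)` near □.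
[4] p. 231 (2.46): «d(y, y′) = inf_{Γ_{y,y′}} Σ_{j=0}^{k} (Lʲη)⁻¹|Γ_{y,y′} ∩ Bʲ(Λ_j)|, y, y′ ∈ 𝔅, (2.46) where the infimum is taken over all
admissible contours described above, with end-points, y, y′» and «d(x, x′) = d(yʲ(x), yʲ′(x′)) if x ∈ Bʲ(Λ_j), x′ ∈ Bʲ′(Λ_{j′})»; (2.51) p. 232 — the
printed instance of the majorant shape `|(Tλ)(x)| ≤ K(y, y′)|λ|` used below (a reading, `B6RandomWalk.HasMajorant`): «|(Rλ)(x)| ≦ O(M⁻¹)e^{−δ₀d(x,y)}|λ| if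
supp λ ⊂ Bʲ(y), y ∈ Λ_j. (2.51)», with p. 232 «where Δ(y) = Bʲ(y) if y ∈ Λ_j».

## WHAT THIS FILE CERTIFIES (kernel-checked; setting of `B9CubeSequence408`; `F := cubeFam D q …`)

The member `D` is a family of the lineage `B6MultiLevelTorusOperator.TDomains` (blocks `B6Geom246MultiLevelBox.bset D.toDomains`, geometry
`B6Geom246MultiLevelTorus.geomT D` — the carrier of def-Y's `BlkY`, `geo9K`); the cube sequence `F` is an `…L0` family on the SAME torus
(blocks `B6Geom246MultiLevelBoxL0.bset F.toDomains`, geometry `B6Geom246MultiLevelTorusL0.geomT F`).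
* §1 **BLOCKS NEST**: two sites of one block of `F` lie in one block of `D` (`blkOf_eq_of_cube_blkOf_eq`; `lev_F ≤ lev_D`, blocks of side `L^n`
  nest, territories are unions of blocks of their own level); the member block `coarsen c` of a cube block `c` (`coarsen_blkOf`); its level is
  at least the cube block's (`scale_le_scale_coarsen`).
* §2 **COARSENING CONTRACTS (2.46)**: touching cube blocks have touching-or-equal member blocks (`touchT_coarsen`), every admissible contour of
  `F` maps to one of `D` that is not longer (`walk_coarsen`), so `d_D(coarsen c, coarsen c′) ≤ d_F(c, c′)` (`dist_coarsen_le`, `geomT_dist_coarsen_le`).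
* §3 **NEAR □ NOTHING CHANGES**: for a site `x` near □ (`NearH`) the cube block and the member block of `x` have the same data `(level, label)`
  (`coarsen_blkOf_val_of_nearH`), and a member block one of whose sites is near □ IS a cube block (`cube_blkOf_eq_of_blkOf_eq_of_nearH`).
* §4 ★ **TRANSFER OF BLOCK MAJORANTS TO THE MEMBER'S GEOMETRY FOR SOURCES NEAR □** (the use of p. 409): if an operator `T` on torus functions
  has the block majorant `C·L^{n·j}·e^{−δ d_F(y,y′)}` over `F` ([4] (2.51) for the cube sequence), then for every MEMBER block `y′` containing a
  site near □, every `λ` with `supp λ ⊂ y′`, `|λ| ≤ B`, and EVERY torus point `x`: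
  `|(Tλ)(x)| ≤ C·L^{n·lev_D x}·e^{−δ d_D(y_D(x), y′)}·B` (`majorant_transfer_of_nearH`) — levels only grow and distances only shrink under
  coarsening, so the cube bound dominates the member-currency bound.

## HONEST SCOPE

* Pure geometry/bookkeeping of the two block structures on one torus; no inequality of the papers.  The GLOBAL transfer (sources anywhere, with a
  loss `δ ↦ δ′ < δ` and a factor `c₁` of Lemma 2.1 (2.61) for the decomposition of a member block into cube blocks) is NOT in this file.
* Nothing is inferred from the manuscript; kernel-checked.  NOT summit progress; the YM mass gap is not proved by any of this.
-/

namespace Literature.MathematicalPhysics.QuantumFieldTheory.Balaban1983to89.B9CubeCoarsening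

open Literature.MathematicalPhysics.QuantumFieldTheory.Balaban1983to89.B4Reflection242 (boxDom blk)
open Literature.MathematicalPhysics.QuantumFieldTheory.Balaban1983to89.B4Thm110ZeroBox (blk_blk)
open Literature.MathematicalPhysics.QuantumFieldTheory.Balaban1983to89.B6MultiLevelBoxOperator (N0)
open Literature.MathematicalPhysics.QuantumFieldTheory.Balaban1983to89.B6Cover236MultiLevelBlocks (cubes)
open Literature.MathematicalPhysics.QuantumFieldTheory.Balaban1983to89.B6Geom246MultiLevelBox (bset blkOf blkOf_val blkOf_eq_iff_blk exists_blkOf_eq)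
open Literature.MathematicalPhysics.QuantumFieldTheory.Balaban1983to89.B6Geom246MultiLevelTorus (TouchT bondT bondT_adj geomT)
open Literature.MathematicalPhysics.QuantumFieldTheory.Balaban1983to89.B6RandomWalk (HasMajorant BlockSupp)
open Literature.MathematicalPhysics.QuantumFieldTheory.Balaban1983to89.B9CubeSequence408 (cubeFam NearH lev_cubeFam_le lev_cubeFam_eq_of_nearH)

variable {d ℓ Mh k R : ℕ} {P : Fin (d + 1) → ℕ} {D : B6MultiLevelTorusOperator.TDomains d ℓ Mh k P R} {q : ↥(cubes D.toDomains)}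
  {hL : Odd (ℓ + 1)} {hM : Odd Mh} {hMh : 1 ≤ Mh} {hP : ∀ μ, 1 ≤ P μ}

/-! ## §1 Blocks of the cube sequence nest in blocks of the member -/

/-- **TWO SITES OF ONE BLOCK OF THE CUBE SEQUENCE LIE IN ONE BLOCK OF THE MEMBER** (`lev_F ≤ lev_D`, nesting of `L^n`-blocks, territories are
unions of blocks of their own level). [cite: Balaban1984PropagatorsII, (2.1)–(2.4) p.224, (2.45) p.231; Balaban1985BackgroundPropagators, p.408] -/
theorem blkOf_eq_of_cube_blkOf_eq {x x' : ↥(boxDom (N0 ℓ Mh k P))}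
    (h : B6Geom246MultiLevelBoxL0.blkOf (cubeFam D q hL hM hMh hP).toDomains x' =
      B6Geom246MultiLevelBoxL0.blkOf (cubeFam D q hL hM hMh hP).toDomains x) :
    blkOf D.toDomains x' = blkOf D.toDomains x := by
  have h1 := congrArg (fun s => s.1) h
  simp only [B6Geom246MultiLevelBoxL0.blkOf_val, Prod.mk.injEq] at h1
  obtain ⟨hlev, hblk⟩ := h1
  have hblk' : blk ((ℓ + 1) ^ (cubeFam D q hL hM hMh hP).lev x.1) x'.1 =
      blk ((ℓ + 1) ^ (cubeFam D q hL hM hMh hP).lev x.1) x.1 := by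
    have e : (cubeFam D q hL hM hMh hP).lev x'.1 = (cubeFam D q hL hM hMh hP).lev x.1 := hlev
    have hb : blk ((ℓ + 1) ^ (cubeFam D q hL hM hMh hP).lev x'.1) x'.1 =
        blk ((ℓ + 1) ^ (cubeFam D q hL hM hMh hP).lev x.1) x.1 := hblk
    rwa [e] at hb
  have hnm : (cubeFam D q hL hM hMh hP).lev x.1 ≤ D.lev x.1 := lev_cubeFam_le x.1
  have hb : blk ((ℓ + 1) ^ D.lev x.1) x'.1 = blk ((ℓ + 1) ^ D.lev x.1) x.1 := by
    rw [show (ℓ + 1) ^ D.lev x.1 = (ℓ + 1) ^ (cubeFam D q hL hM hMh hP).lev x.1 *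
        (ℓ + 1) ^ (D.lev x.1 - (cubeFam D q hL hM hMh hP).lev x.1) by rw [← pow_add, Nat.add_sub_cancel' hnm],
      ← blk_blk, ← blk_blk, hblk']
  exact (blkOf_eq_iff_blk D.toDomains).2 hb

/-- **THE MEMBER BLOCK OF A CUBE BLOCK** (the block of `D` containing the cube block's corner, hence all of it).
[cite: Balaban1984PropagatorsII, (2.45) p.231, dictionary] -/
noncomputable def coarsen (c : ↥(B6Geom246MultiLevelBoxL0.bset (cubeFam D q hL hM hMh hP).toDomains)) : ↥(bset D.toDomains) :=
  blkOf D.toDomains ⟨B6Geom246MultiLevelBoxL0.corner (cubeFam D q hL hM hMh hP).toDomains c,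
    B6Geom246MultiLevelBoxL0.corner_mem (cubeFam D q hL hM hMh hP).toDomains c⟩

/-- the member block of the cube block of `x` is the member block of `x`. [cite: Balaban1984PropagatorsII, (2.45) p.231, bookkeeping] -/
theorem coarsen_blkOf (x : ↥(boxDom (N0 ℓ Mh k P))) :
    coarsen (B6Geom246MultiLevelBoxL0.blkOf (cubeFam D q hL hM hMh hP).toDomains x) = blkOf D.toDomains x :=
  blkOf_eq_of_cube_blkOf_eq (B6Geom246MultiLevelBoxL0.blkOf_corner (cubeFam D q hL hM hMh hP).toDomains _)

/-- **LEVELS ONLY GROW UNDER COARSENING**: `j(c) ≤ j(coarsen c)`. [cite: Balaban1985BackgroundPropagators, p.408 (Ω_n(□) ⊂ Ω_n), bookkeeping] -/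
theorem scale_le_scale_coarsen (c : ↥(B6Geom246MultiLevelBoxL0.bset (cubeFam D q hL hM hMh hP).toDomains)) :
    c.1.1 ≤ (coarsen c).1.1 := by
  have hc := congrArg (fun s => s.1.1) (B6Geom246MultiLevelBoxL0.blkOf_corner (cubeFam D q hL hM hMh hP).toDomains c)
  simp only [B6Geom246MultiLevelBoxL0.blkOf_val] at hc
  have hc' : c.1.1 = (cubeFam D q hL hM hMh hP).lev (B6Geom246MultiLevelBoxL0.corner (cubeFam D q hL hM hMh hP).toDomains c) :=
    hc.symm
  show c.1.1 ≤ D.lev (B6Geom246MultiLevelBoxL0.corner (cubeFam D q hL hM hMh hP).toDomains c)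
  rw [hc']
  exact lev_cubeFam_le _

/-! ## §2 Coarsening contracts the admissible-bond distance (2.46) -/

/-- touching cube blocks have touching member blocks (same witnessing sites). [cite: Balaban1984PropagatorsII, (2.46) p.231] -/
theorem touchT_coarsen {c c' : ↥(B6Geom246MultiLevelBoxL0.bset (cubeFam D q hL hM hMh hP).toDomains)}
    (h : B6Geom246MultiLevelTorusL0.TouchT (cubeFam D q hL hM hMh hP) c c') : TouchT D (coarsen c) (coarsen c') := by
  obtain ⟨x, x', hx, hx', hd⟩ := h
  exact ⟨x, x', by rw [← hx, coarsen_blkOf], by rw [← hx', coarsen_blkOf], hd⟩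

/-- **EVERY ADMISSIBLE CONTOUR OF THE CUBE SEQUENCE MAPS TO ONE OF THE MEMBER, NOT LONGER** (equal consecutive images are dropped).
[cite: Balaban1984PropagatorsII, (2.46) p.231] -/
theorem walk_coarsen {c c' : ↥(B6Geom246MultiLevelBoxL0.bset (cubeFam D q hL hM hMh hP).toDomains)}
    (p : (B6Geom246MultiLevelTorusL0.bondT (cubeFam D q hL hM hMh hP)).Walk c c') :
    ∃ p' : (bondT D).Walk (coarsen c) (coarsen c'), p'.length ≤ p.length := by
  induction p with
  | nil => exact ⟨SimpleGraph.Walk.nil, le_rfl⟩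
  | @cons u v w hadj p ih =>
    obtain ⟨p', hp'⟩ := ih
    by_cases heq : coarsen u = coarsen v
    · refine ⟨p'.copy heq.symm rfl, ?_⟩
      rw [SimpleGraph.Walk.length_copy, SimpleGraph.Walk.length_cons]
      omega
    · refine ⟨SimpleGraph.Walk.cons (bondT_adj.2 ⟨heq, touchT_coarsen (B6Geom246MultiLevelTorusL0.bondT_adj.1 hadj).2⟩) p', ?_⟩
      rw [SimpleGraph.Walk.length_cons, SimpleGraph.Walk.length_cons]
      omega

/-- **`d_D(coarsen c, coarsen c′) ≤ d_F(c, c′)`**: the member's (2.46) distance is at most the cube sequence's.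
[cite: Balaban1984PropagatorsII, (2.46) p.231; Balaban1985BackgroundPropagators, p.409 ((3.89) read in the member's Δ(y))] -/
theorem dist_coarsen_le (hMh : 1 ≤ Mh) (hP : ∀ μ, 1 ≤ P μ) {hM : Odd Mh} {hL : Odd (ℓ + 1)}
    (c c' : ↥(B6Geom246MultiLevelBoxL0.bset (cubeFam D q hL hM hMh hP).toDomains)) :
    (bondT D).dist (coarsen c) (coarsen c') ≤ (B6Geom246MultiLevelTorusL0.bondT (cubeFam D q hL hM hMh hP)).dist c c' := by
  obtain ⟨p, hp⟩ :=
    ((B6Geom246MultiLevelTorusL0.connectedT (D := cubeFam D q hL hM hMh hP) hMh hP).preconnected c c').exists_walk_length_eq_dist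
  obtain ⟨p', hp'⟩ := walk_coarsen p
  exact (SimpleGraph.dist_le p').trans (hp'.trans hp.le)

/-- the same in the `B6.Geometry` currency: `(geomT D).dist (coarsen c) (coarsen c′) ≤ (geomT F).dist c c′`.
[cite: Balaban1984PropagatorsII, (2.46) p.231] -/
theorem geomT_dist_coarsen_le (hMh : 1 ≤ Mh) (hP : ∀ μ, 1 ≤ P μ) {hM : Odd Mh} {hL : Odd (ℓ + 1)}
    (c c' : ↥(B6Geom246MultiLevelBoxL0.bset (cubeFam D q hL hM hMh hP).toDomains)) :
    (geomT D).dist (coarsen c) (coarsen c') ≤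
      (B6Geom246MultiLevelTorusL0.geomT (cubeFam D q hL hM hMh hP)).dist c c' := by
  show ((bondT D).dist (coarsen c) (coarsen c') : ℝ) ≤
    ((B6Geom246MultiLevelTorusL0.bondT (cubeFam D q hL hM hMh hP)).dist c c' : ℝ)
  exact_mod_cast dist_coarsen_le hMh hP c c'

/-! ## §3 Near □ the two block structures coincide -/

/-- **NEAR □ THE CUBE BLOCK AND THE MEMBER BLOCK OF A SITE HAVE THE SAME DATA** `(level, label)`.
[cite: Balaban1985BackgroundPropagators, p.408 (□̃³ ⊂ Ω_j(□) = □̃⁴), (3.89) p.409; Balaban1984PropagatorsII, (2.45) p.231] -/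
theorem coarsen_blkOf_val_of_nearH (hR : 2 ≤ R) {x : ↥(boxDom (N0 ℓ Mh k P))} (hx : NearH q x.1) :
    (blkOf D.toDomains x).1 = (B6Geom246MultiLevelBoxL0.blkOf (cubeFam D q hL hM hMh hP).toDomains x).1 := by
  have h0 : (cubeFam D q hL hM hMh hP).lev x.1 = D.lev x.1 := lev_cubeFam_eq_of_nearH hR x.2 hx
  show (D.lev x.1, blk ((ℓ + 1) ^ D.lev x.1) x.1) =
    ((cubeFam D q hL hM hMh hP).lev x.1, blk ((ℓ + 1) ^ (cubeFam D q hL hM hMh hP).lev x.1) x.1)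
  rw [h0]

/-- **A MEMBER BLOCK WITH A SITE NEAR □ IS A CUBE BLOCK**: all its sites have one and the same cube block.
[cite: Balaban1985BackgroundPropagators, p.408, (3.89) p.409; Balaban1984PropagatorsII, (2.45) p.231] -/
theorem cube_blkOf_eq_of_blkOf_eq_of_nearH (hR : 2 ≤ R) {x₀ x : ↥(boxDom (N0 ℓ Mh k P))} (hx₀ : NearH q x₀.1)
    (h : blkOf D.toDomains x = blkOf D.toDomains x₀) :
    B6Geom246MultiLevelBoxL0.blkOf (cubeFam D q hL hM hMh hP).toDomains x =
      B6Geom246MultiLevelBoxL0.blkOf (cubeFam D q hL hM hMh hP).toDomains x₀ := by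
  -- the member data of `x` and `x₀` agree; `x₀`'s member data are its cube data; the cube label of `x` at the level `lev_D x₀` is then
  -- `x₀`'s, so `x` lies in `x₀`'s cube block (`blkOf_eq_iff_blk` of the `…L0` lineage), whence the cube data agree.
  have h1 := congrArg (fun s => s.1) h
  simp only [blkOf_val, Prod.mk.injEq] at h1
  obtain ⟨hlev, hblk⟩ := h1
  have h0 : (cubeFam D q hL hM hMh hP).lev x₀.1 = D.lev x₀.1 := lev_cubeFam_eq_of_nearH hR x₀.2 hx₀
  have hlev' : D.lev x.1 = D.lev x₀.1 := hlev
  have hblk' : blk ((ℓ + 1) ^ D.lev x.1) x.1 = blk ((ℓ + 1) ^ D.lev x₀.1) x₀.1 := hblk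
  rw [hlev'] at hblk'
  refine (B6Geom246MultiLevelBoxL0.blkOf_eq_iff_blk _).2 ?_
  show blk ((ℓ + 1) ^ (cubeFam D q hL hM hMh hP).lev x₀.1) x.1 = blk ((ℓ + 1) ^ (cubeFam D q hL hM hMh hP).lev x₀.1) x₀.1
  rw [h0]
  exact hblk'

/-! ## §4 Transfer of block majorants to the member's geometry for sources near □ -/

/-- ★ **BLOCK MAJORANTS OVER THE CUBE SEQUENCE GIVE MEMBER-CURRENCY BOUNDS FOR SOURCES NEAR □**: if `T` has the (2.51)-majorant
`C·L^{n·j(y)}·e^{−δ·d_F(y,y′)}` over the cube sequence `F`, then for a member block `y′` with a site near □, `supp λ ⊂ y′`, `|λ| ≤ B` and every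
torus point `x`: `|(Tλ)(x)| ≤ C·L^{n·lev_D x}·e^{−δ·d_D(y_D(x), y′)}·B`.
[cite: Balaban1984PropagatorsII, (2.51) p.232, (2.46) p.231; Balaban1985BackgroundPropagators, (3.89) p.409 («for x ∈ Δ(y), supp λ ⊂ Δ(y′), y, y′ ∈ □»)] -/
theorem majorant_transfer_of_nearH (hR : 2 ≤ R) {T : Module.End ℝ (↥(boxDom (N0 ℓ Mh k P)) → ℝ)} {C δ : ℝ} {n : ℕ}
    (hC : 0 ≤ C) (hδ : 0 ≤ δ)
    (hT : HasMajorant (g := B6Geom246MultiLevelTorusL0.geomT (cubeFam D q hL hM hMh hP))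
      (B6Geom246MultiLevelBoxL0.blkOf (cubeFam D q hL hM hMh hP).toDomains) T
      (fun y y' => C * ((ℓ : ℝ) + 1) ^ (n * y.1.1) *
        Real.exp (-(δ * (B6Geom246MultiLevelTorusL0.geomT (cubeFam D q hL hM hMh hP)).dist y y'))))
    (y' : ↥(bset D.toDomains)) {x₀ : ↥(boxDom (N0 ℓ Mh k P))} (hy' : blkOf D.toDomains x₀ = y') (hx₀ : NearH q x₀.1)
    (μ : ↥(boxDom (N0 ℓ Mh k P)) → ℝ) (B : ℝ) (hμ : BlockSupp (g := geomT D) (blkOf D.toDomains) μ y' B)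
    (x : ↥(boxDom (N0 ℓ Mh k P))) :
    |T μ x| ≤ C * ((ℓ : ℝ) + 1) ^ (n * D.lev x.1) * Real.exp (-(δ * (geomT D).dist (blkOf D.toDomains x) y')) * B := by
  -- the source member block is the cube block `c₀` of `x₀`
  have hsame : ∀ z : ↥(boxDom (N0 ℓ Mh k P)), blkOf D.toDomains z = y' →
      B6Geom246MultiLevelBoxL0.blkOf (cubeFam D q hL hM hMh hP).toDomains z =
        B6Geom246MultiLevelBoxL0.blkOf (cubeFam D q hL hM hMh hP).toDomains x₀ := fun z hz =>
    cube_blkOf_eq_of_blkOf_eq_of_nearH hR hx₀ (hz.trans hy'.symm)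
  have hμF : BlockSupp (g := B6Geom246MultiLevelTorusL0.geomT (cubeFam D q hL hM hMh hP))
      (B6Geom246MultiLevelBoxL0.blkOf (cubeFam D q hL hM hMh hP).toDomains) μ
      (B6Geom246MultiLevelBoxL0.blkOf (cubeFam D q hL hM hMh hP).toDomains x₀) B := by
    refine ⟨hμ.nonneg, fun z hz => hμ.bound z ?_, fun z hz => hμ.off z fun hz' => hz (hsame z hz')⟩
    rw [← coarsen_blkOf (hL := hL) (hM := hM) (hMh := hMh) (hP := hP) z, hz, coarsen_blkOf, hy']
  have h := hT _ μ B hμF x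
  refine h.trans (mul_le_mul_of_nonneg_right ?_ hμ.nonneg)
  beta_reduce
  have hL1 : (1 : ℝ) ≤ (ℓ : ℝ) + 1 := by linarith [(Nat.cast_nonneg ℓ : (0 : ℝ) ≤ ℓ)]
  have hlev : (B6Geom246MultiLevelBoxL0.blkOf (cubeFam D q hL hM hMh hP).toDomains x).1.1 ≤ D.lev x.1 :=
    lev_cubeFam_le (hL := hL) (hM := hM) (hMh := hMh) (hP := hP) x.1
  have hdist : (geomT D).dist (blkOf D.toDomains x) y' ≤
      (B6Geom246MultiLevelTorusL0.geomT (cubeFam D q hL hM hMh hP)).dist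
        (B6Geom246MultiLevelBoxL0.blkOf (cubeFam D q hL hM hMh hP).toDomains x)
        (B6Geom246MultiLevelBoxL0.blkOf (cubeFam D q hL hM hMh hP).toDomains x₀) := by
    rw [← coarsen_blkOf (hL := hL) (hM := hM) (hMh := hMh) (hP := hP) x, ← hy',
      ← coarsen_blkOf (hL := hL) (hM := hM) (hMh := hMh) (hP := hP) x₀]
    exact geomT_dist_coarsen_le hMh hP _ _
  refine mul_le_mul (mul_le_mul_of_nonneg_left (pow_le_pow_right₀ hL1 (Nat.mul_le_mul_left n hlev)) hC)
    (Real.exp_le_exp.2 ?_) (Real.exp_nonneg _) (mul_nonneg hC (pow_nonneg (by linarith) _))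
  nlinarith

end Literature.MathematicalPhysics.QuantumFieldTheory.Balaban1983to89.B9CubeCoarsening
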